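import Mathlib
import Summits.ResolutionOfSingularities.ResolutionOfSingularities.Theorems.WeightedInvariantLocalWeightedDropNewtonSetChartLaws
import Summits.ResolutionOfSingularities.ResolutionOfSingularities.Theorems.WeightedInvariantLocalWeightedDropWildMonicFlagDefs

/-!
# `WeightedInvariant.LocalWeightedDrop`, line `hasse-ridge-face-selection`, S3ρ sub-stub S3ρD `stub_wildMonicSurfaceDescent`:
# CASE D-b, the branch `d_{𝓕,x} = 0` of Lemma 9.1.3 — the successor after a kangaroo-direction point step is of MONOMIAL TYPE

Crux item stmt-ResolutionOfSingularities-8899 `LocalWeightedDrop` (route `ResolutionOfSingularities/WeightedInvariant`), engine of the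
door `HypersurfaceCentreConstruction` stmt-ResolutionOfSingularities-19897.  [OURS · L1 W4.3, chain w43, res-L1-w43-stub-5 = seat
res-D-pv-056, third seat on S3ρ under res-type-083 (case D-b of `L/res-type-083/S3RHO-DESIGN.md` §1(D)); sibling of
`…WildMonicFlagN1Transport` (the `n_𝓕 = 1` transport and the small-residual branch).  MODEL: Perlega, arXiv:2011.14443, Ch. 9
Lemma 9.1.3 (`n_𝓕 = 1`, `d_𝓕 = −1` ⇒ terminal), the branch «`ord_{(y)} in(J₂) = 0` ⇒ `J₂′ = (x^{ord J₂ − c!})` principal monomial»;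
nothing here is a statement of H. Hironaka's manuscript; OUR lemmas about OUR point-set numbers.]

* `deltaL_eq_alphaL_of_lost_image_psi` — if the `δ`-face of the source set `N` contains a point on the axis (`P₁ = 0`, i.e. the initial
  form of `J₂` has the pure power `x₁^{ord J₂}`: `d_{𝓕,x} = 0` for the `n = 1` flag), then the successor set `N′ = psi L '' N` has
  `deltaL N′ = alphaL N′ = deltaL N − L`: its order is carried by a single monomial `x₁^{δ − L}`;
* `termMono_data_of_newtonSet` — THE COEFFICIENT-LEVEL READING: a tuple `A′` whose scaled Newton set has `deltaL = alphaL` (= `a`) carries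
  the data (i) «every point is `≥ (a, 0)` slot-wise» and (ii) «the vertex `(a, 0)` is attained by a coefficient» of the MONOMIAL TYPE of
  res-type-083's terminal predicate (`WildMonic.Terminal`, first disjunct, with `N := d!`, `(a, b) := (a, 0)`); the third clause
  (non-solvability of the vertex when `d! ∣ a`) is a cleanness condition on coefficients and stays with the supplier's preparation (D-0).
AI-written; gate-accepted means sorry-free with standard axioms, not refereed.
-/

set_option linter.dupNamespace false -- mandated namespace of this single-conjunct summit

namespace Summit.ResolutionOfSingularities.ResolutionOfSingularities.Theorems

namespace WildMonic

open MonicDescent MvPowerSeries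

variable {N : Set (Fin 2 →₀ ℕ)} {L : ℕ}

/-! ## Point sets: a face point on the axis makes the successor's order monomial -/

/-- THE BRANCH `d_{𝓕,x} = 0`: if some point of the `δ`-face of `N` lies on the `x₁`-axis (`P₁ = 0`), then after the monomial step `psi L`
the successor set has `deltaL = alphaL = deltaL N − L` — its `(1,1)`-order and its `x₁`-order coincide,
i.e. `J₂′` has the order of the single monomial `x₁^{δ − L}` (Perlega Lemma 9.1.3, monomial branch). -/
theorem deltaL_eq_alphaL_of_lost_image_psi (hN : N.Nonempty)
    {P : Fin 2 →₀ ℕ} (hP : P ∈ N) (hPd : P 0 + P 1 = deltaL N) (hP1 : P 1 = 0) :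
    deltaL (psi L '' N) = deltaL N - L ∧ alphaL (psi L '' N) = deltaL N - L := by
  have hα := alphaL_image_psiC L hN
  refine ⟨le_antisymm ?_ ?_, hα⟩
  · have h := deltaL_le (N := psi L '' N) ⟨P, hP, rfl⟩
    rw [psi_apply_zero, psi_apply_one] at h
    omega
  · obtain ⟨Q, ⟨R, hR, rfl⟩, hQd⟩ := exists_eq_deltaL (hN.image (psi L))
    rw [← hQd, psi_apply_zero, psi_apply_one]
    have := deltaL_le hR
    omega

/-- Consequence: the `δ′`-face of the successor set is the single axis point `(deltaL N − L, 0)`, which is attained. -/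
theorem face_of_lost_image_psi (hN : N.Nonempty)
    {P : Fin 2 →₀ ℕ} (hP : P ∈ N) (hPd : P 0 + P 1 = deltaL N) (hP1 : P 1 = 0) :
    (∀ Q ∈ psi L '' N, Q 0 + Q 1 = deltaL (psi L '' N) → Q 0 = deltaL N - L ∧ Q 1 = 0) ∧
      (psi L P ∈ psi L '' N ∧ psi L P 0 = deltaL N - L ∧ psi L P 1 = 0) := by
  obtain ⟨hδ, hα⟩ := deltaL_eq_alphaL_of_lost_image_psi hN hP hPd hP1
  refine ⟨fun Q hQ hQd => ?_, ⟨P, hP, rfl⟩, ?_, ?_⟩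
  · have h0 := alphaL_le hQ
    rw [hα] at h0
    rw [hδ] at hQd
    omega
  · rw [psi_apply_zero, hPd]
  · rw [psi_apply_one, hP1]

/-! ## The coefficient-level reading: monomial type, clauses (i) and (ii) -/

variable {k : Type} [Field k]

/-- THE COEFFICIENT-LEVEL READING OF THE MONOMIAL BRANCH (input shape of res-type-083's `WildMonic.Terminal`, first disjunct, with the
scale `N := d!` and the vertex `(a, 0)`): if the `d!`-scaled Newton set of a tuple `A′ = (A′_j)_{j<d}` is nonempty with
`deltaL = alphaL = a`, then (i) every exponent `β` of every `A′_j` satisfies `(d − j)·a ≤ d!·β₀` (and trivially `(d − j)·0 ≤ d!·β₁`),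
and (ii) some coefficient realises the vertex: `d!·β₀ = (d − j₀)·a`, `d!·β₁ = 0`, `[x^β] A′_{j₀} ≠ 0`.  The non-solvability clause
(iii) of the monomial type is a condition on these vertex coefficients (the supplier's cleaning), not on the point set. -/
theorem termMono_data_of_newtonSet {d : ℕ} (A : Fin d → MvPowerSeries (Fin 2) k) (hne : (newtonSet A).Nonempty)
    {a : ℕ} (hδ : deltaL (newtonSet A) = a) (hα : alphaL (newtonSet A) = a) :
    (∀ (j : Fin d) (β : Fin 2 →₀ ℕ), coeff β (A j) ≠ 0 →
        (d - (j : ℕ)) * a ≤ d.factorial * β 0 ∧ (d - (j : ℕ)) * 0 ≤ d.factorial * β 1) ∧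
      ∃ (j₀ : Fin d) (β : Fin 2 →₀ ℕ), d.factorial * β 0 = (d - (j₀ : ℕ)) * a ∧ d.factorial * β 1 = (d - (j₀ : ℕ)) * 0 ∧
        coeff β (A j₀) ≠ 0 := by
  constructor
  · intro j β hβ
    refine ⟨?_, by rw [mul_zero]; exact Nat.zero_le _⟩
    have hmem : slotWeight d j • β ∈ newtonSet A := ⟨j, β, hβ, rfl⟩
    have h0 := alphaL_le hmem
    rw [hα, Finsupp.smul_apply, smul_eq_mul] at h0
    calc (d - (j : ℕ)) * a ≤ (d - (j : ℕ)) * (slotWeight d j * β 0) := Nat.mul_le_mul_left _ h0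
      _ = d.factorial * β 0 := by rw [← mul_assoc, mul_comm (d - (j : ℕ)), slotWeight_mul_sub]
  · -- the face point: total degree `a` and first coordinate `≥ a` force it onto the axis
    obtain ⟨Q, hQ, hQd⟩ := exists_eq_deltaL hne
    obtain ⟨j₀, β, hβ, rfl⟩ := hQ
    have h0 := alphaL_le (N := newtonSet A) ⟨j₀, β, hβ, rfl⟩
    rw [hα, Finsupp.smul_apply, smul_eq_mul] at h0
    rw [hδ, Finsupp.smul_apply, Finsupp.smul_apply, smul_eq_mul, smul_eq_mul] at hQd
    have hw := slotWeight_mul_sub j₀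
    have hwpos := slotWeight_pos j₀
    have hβ1 : β 1 = 0 := by
      have h1 : slotWeight d j₀ * β 1 = 0 := by omega
      rcases Nat.mul_eq_zero.mp h1 with h | h
      · exact absurd h hwpos.ne'
      · exact h
    have hβ0 : slotWeight d j₀ * β 0 = a := by rw [hβ1, mul_zero, add_zero] at hQd; exact hQd
    refine ⟨j₀, β, ?_, by rw [hβ1, mul_zero, mul_zero], hβ⟩
    calc d.factorial * β 0 = (d - (j₀ : ℕ)) * (slotWeight d j₀ * β 0) := by
          rw [← mul_assoc, mul_comm (d - (j₀ : ℕ)), slotWeight_mul_sub]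
      _ = (d - (j₀ : ℕ)) * a := by rw [hβ0]

end WildMonic

end Summit.ResolutionOfSingularities.ResolutionOfSingularities.Theorems
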